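import Literature.NumberTheory.Irrationality.DirichletLValues.ChowlaMilnorLFunctionProofs
import HarnessLib

/-!
# Chowla's question at the integers `k > 1`, II: the parity half of the Chowla–Milnor conjecture in
# `L`-function form (Gun–Murty–Rath 2011, Theorem 1 with eq. (1))

Topic `Literature/NumberTheory/Irrationality/DirichletLValues`. Proofs-only leaf (theorems only, no definition, no
named fact, no `sorry`; cell pub-zeta5, P1 g53), sequel of `ChowlaMilnorLFunctionProofs.lean` (eq. (1), the p. 1329
display, Chowla–Chowla ⟺ Milnor).

## Source (read on the page)

S. Gun, M. R. Murty, P. Rath, *On a conjecture of Chowla and Milnor*, Canad. J. Math. **63** (2011) 1328–1344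
[GunRammurtyRath2011]: eq. (1) p. 1328 «`L(s, f) = q^{−s} Σ_{a=1}^{q} f(a) ζ(s, a/q)`»; the Chowla–Chowla and Milnor
conjectures and the display `L(k, f) = p^{−k} Σ_{a=1}^{p−1} [f(a) + f(p)/(p^k − 1)] ζ(k, a/p)` (p. 1329); **Theorem 1**
(p. 1330) «Let `k > 1` and `q > 2`, then `dim_ℚ V_k(q) ≥ φ(q)/2`» with its proof (p. 1332): `V_k(q)` is spanned by the
`ζ(k, a/q) ± ζ(k, 1 − a/q)`, `(a,q) = 1`, `1 ≤ a < q/2`, and by Okada's **Lemma 1** with eq. (2) the `φ(q)/2` numbers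
`ζ(k, a/q) + (−1)^k ζ(k, 1 − a/q)` are linearly independent over `ℚ` — in the tree the PROVED
`okada_linearIndependent_hurwitzZeta_holds` (P1 g49) with the bridge `Okada.ofReal_hurwitz_symm`.

## What is proved

* `ChowlaMilnorL.sum_mul_eq_sum_half` — for `Φ` of parity `ε` on `ℤ/N` (`N ≥ 3`) vanishing at the non-units:
  `Σ_j Φ(j) Z(j) = Σ_{2a<N, (a,N)=1} Φ(a) (Z(a) + ε Z(−a))` (pairing `a ↔ −a`; no unit sits at `N/2`);
* **`LFunction_natCast_ne_zero_of_parity`** — `q ≥ 3`, `k ≥ 2`, `f : ℤ/q → ℚ` with `f(−a) = (−1)^k f(a)`, vanishing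
  at the non-units, `f ≠ 0` ⇒ `L(k, f) ≠ 0`: the unconditional parity half of the Chowla–Milnor conjecture, read in
  the `L`-function form of p. 1329 (`dim_ℚ V_k^{±}(q) = φ(q)/2` for the sign `(−1)^k`);
* **`chowlaChowla_of_parity`** — prime `p`, `k ≥ 2`: every `f : ℤ/p → ℚ` of parity `(−1)^k` with `L(k, f) = 0` is the
  exceptional function `f(a) = f(0)/(1 − p^k)` (`a ≢ 0`) of the Chowla–Chowla conjecture (for odd `k`: `f = 0`).

HONEST FRAMING: the parity-`(−1)^k` half is a theorem (Okada 1981 / GMR Theorem 1); the complementary half — and with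
it the Chowla–Chowla, Milnor and Chowla–Milnor conjectures — stays OPEN; nothing here concerns `ζ(5)`.
-/

noncomputable section

open Complex Finset HurwitzZeta

namespace Literature.NumberTheory.Irrationality.DirichletLValues

open Literature.NumberTheory.Transcendental

/-! ### The parity half of the Chowla–Milnor conjecture, in `L`-function form -/

namespace ChowlaMilnorL

variable {N : ℕ} [NeZero N]

/-- Every unit mod `N ≥ 3` is `±a` for exactly… at least one `a` in the lower half-system
`{a : 2a < N, (a, N) = 1}` (no unit sits at `N/2`: `2ã = N` would give `ã ∣ N`, `ã = 1`, `N = 2`). [folklore] -/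
private theorem exists_half_rep (hN : 2 < N) {j : ZMod N} (hj : IsUnit j) :
    ∃ a : ℕ, 2 * a < N ∧ a.Coprime N ∧ ((a : ZMod N) = j ∨ (a : ZMod N) = -j) := by
  haveI : Fact (1 < N) := ⟨by omega⟩
  have hj0 : j ≠ 0 := hj.ne_zero
  have hcop : j.val.Coprime N := by
    have h := hj
    rw [← ZMod.natCast_zmod_val j] at h
    exact (ZMod.isUnit_iff_coprime j.val N).mp h
  have hcop' : (-j).val.Coprime N := by
    have h := hj.neg
    rw [← ZMod.natCast_zmod_val (-j)] at h
    exact (ZMod.isUnit_iff_coprime (-j).val N).mp h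
  have hne : 2 * j.val ≠ N := by
    intro h
    have h1 : j.val = 1 := Nat.Coprime.eq_one_of_dvd hcop ⟨2, by omega⟩
    omega
  have hneg : (-j).val = N - j.val := by rw [ZMod.neg_val, if_neg hj0]
  have hlt := ZMod.val_lt j
  by_cases h : 2 * j.val < N
  · exact ⟨j.val, h, hcop, Or.inl (ZMod.natCast_zmod_val j)⟩
  · refine ⟨(-j).val, by omega, hcop', Or.inr (ZMod.natCast_zmod_val (-j))⟩

/-- **Folding `Σ_j Φ(j) ζ_j` onto the half-system** for `Φ` of parity `ε` (`Φ(−j) = ε Φ(j)`) vanishing at the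
non-units, `N ≥ 3`: `Σ_{j mod N} Φ(j) Z(j) = Σ_{2a<N, (a,N)=1} Φ(a) (Z(a) + ε Z(−a))` for any `Z : ℤ/N → ℂ`.
[cite: GunRammurtyRath2011, proof of Theorem 1 (p. 1332: `V_k(q)` is spanned by the `ζ(k,a/q) ± ζ(k,1−a/q)`)] -/
theorem sum_mul_eq_sum_half (hN : 2 < N) {Φ : ZMod N → ℂ} {ε : ℂ} (hpar : ∀ j, Φ (-j) = ε * Φ j)
    (hsupp : ∀ j : ZMod N, ¬ IsUnit j → Φ j = 0) (Z : ZMod N → ℂ) :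
    ∑ j : ZMod N, Φ j * Z j =
      ∑ a ∈ (range N).filter (fun a => 2 * a < N ∧ a.Coprime N),
        Φ (a : ZMod N) * (Z (a : ZMod N) + ε * Z (-(a : ZMod N))) := by
  haveI : Fact (1 < N) := ⟨by omega⟩
  set H : Finset ℕ := (range N).filter (fun a => 2 * a < N ∧ a.Coprime N) with hH
  set F : ZMod N → ℂ := fun j => Φ j * Z j with hF
  have hmemH : ∀ a : ℕ, a ∈ H ↔ 2 * a < N ∧ a.Coprime N := fun a => by
    simp only [hH, Finset.mem_filter, Finset.mem_range]
    exact ⟨fun h => h.2, fun h => ⟨by omega, h⟩⟩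
  -- the two injections `a ↦ a`, `a ↦ −a` of `H` into `ℤ/N`
  have hinj1 : Set.InjOn (fun a : ℕ => (a : ZMod N)) H := by
    intro a ha b hb h
    have ha' := ((hmemH a).mp ha).1
    have hb' := ((hmemH b).mp hb).1
    have := (ZMod.natCast_eq_natCast_iff' a b N).mp h
    rw [Nat.mod_eq_of_lt (by omega), Nat.mod_eq_of_lt (by omega)] at this
    exact this
  have hinj2 : Set.InjOn (fun a : ℕ => -(a : ZMod N)) H := fun a ha b hb h => hinj1 ha hb (neg_injective h)
  set T : Finset (ZMod N) := H.image (fun a : ℕ => (a : ZMod N)) with hT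
  set T' : Finset (ZMod N) := H.image (fun a : ℕ => -(a : ZMod N)) with hT'
  have hval : ∀ a ∈ H, ((a : ZMod N)).val = a := fun a ha =>
    ZMod.val_cast_of_lt (by have := ((hmemH a).mp ha).1; omega)
  -- disjointness: `a = −b` with `a, b` in the lower half is impossible
  have hdisj : Disjoint T T' := by
    rw [Finset.disjoint_left]
    rintro j hj hj'
    obtain ⟨a, ha, rfl⟩ := Finset.mem_image.mp hj
    obtain ⟨b, hb, hab⟩ := Finset.mem_image.mp hj'
    have ha' := (hmemH a).mp ha
    have hb' := (hmemH b).mp hb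
    -- `a + b ≡ 0 (mod N)` with `0 < a + b < N`
    have hsum : (((a + b : ℕ)) : ZMod N) = 0 := by push_cast; rw [← hab]; ring
    rw [ZMod.natCast_eq_zero_iff] at hsum
    have hapos : 0 < a := Nat.pos_of_ne_zero fun h0 => by
      rw [h0, Nat.coprime_zero_left] at ha'; omega
    have := Nat.le_of_dvd (by omega) hsum
    omega
  -- `F` vanishes off `T ∪ T'`
  have hvanish : ∀ j ∈ (Finset.univ : Finset (ZMod N)), j ∉ T ∪ T' → F j = 0 := by
    intro j _ hj
    by_cases hu : IsUnit j
    · exfalso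
      obtain ⟨a, ha2, hacop, h⟩ := exists_half_rep hN hu
      have haH : a ∈ H := (hmemH a).mpr ⟨ha2, hacop⟩
      rcases h with h | h
      · exact hj (Finset.mem_union_left _ (Finset.mem_image.mpr ⟨a, haH, h⟩))
      · exact hj (Finset.mem_union_right _ (Finset.mem_image.mpr ⟨a, haH, by rw [h, neg_neg]⟩))
    · simp only [hF, hsupp j hu, zero_mul]
  calc ∑ j : ZMod N, F j = ∑ j ∈ T ∪ T', F j := (Finset.sum_subset (Finset.subset_univ _) hvanish).symm
    _ = ∑ j ∈ T, F j + ∑ j ∈ T', F j := Finset.sum_union hdisj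
    _ = ∑ a ∈ H, F (a : ZMod N) + ∑ a ∈ H, F (-(a : ZMod N)) := by
        rw [hT, hT', Finset.sum_image hinj1, Finset.sum_image hinj2]
    _ = ∑ a ∈ H, Φ (a : ZMod N) * (Z (a : ZMod N) + ε * Z (-(a : ZMod N))) := by
        rw [← Finset.sum_add_distrib]
        refine Finset.sum_congr rfl fun a _ => ?_
        simp only [hF, hpar]
        ring

end ChowlaMilnorL

open ChowlaMilnorL

/-- **The parity half of the Chowla–Milnor conjecture, in `L`-function form — PROVED.** Let `q ≥ 3`, `k ≥ 2`, and let
`f : ℤ/qℤ → ℚ` satisfy `f(−a) = (−1)^k f(a)`, vanish at the non-units, and be not identically zero. Then `L(k, f) ≠ 0`.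
Indeed by eq. (1) `q^k L(k, f) = Σ_{(a,q)=1} f(a) ζ(k, a/q) = Σ_{2a<q, (a,q)=1} f(a) (ζ(k, a/q) + (−1)^k ζ(k, 1 − a/q))`,
and these `φ(q)/2` combinations are linearly independent over `ℚ` — the proof of Theorem 1 (Okada's Lemma 1 with
eq. (2)); in the kernel `okada_linearIndependent_hurwitzZeta_holds`. (Equivalently: `dim_ℚ V_k^{±}(q) = φ(q)/2` for the
sign `± = (−1)^k`.) [cite: GunRammurtyRath2011, Theorem 1 and its proof (p. 1332), with eq. (1) (p. 1328)] -/
theorem LFunction_natCast_ne_zero_of_parity {q : ℕ} [NeZero q] (hq : 2 < q) {k : ℕ} (hk : 2 ≤ k)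
    (f : ZMod q → ℚ) (hpar : ∀ a : ZMod q, f (-a) = (-1) ^ k * f a)
    (hsupp : ∀ a : ZMod q, ¬ IsUnit a → f a = 0) (hf : f ≠ 0) :
    ZMod.LFunction (fun j => ((f j : ℚ) : ℂ)) k ≠ 0 := by
  haveI : Fact (1 < q) := ⟨by omega⟩
  intro hL
  set Φ : ZMod q → ℂ := fun j => ((f j : ℚ) : ℂ) with hΦ
  have hΦpar : ∀ j, Φ (-j) = ((-1 : ℂ) ^ k) * Φ j := fun j => by
    simp only [hΦ, hpar j]; push_cast; ring
  have hΦsupp : ∀ j : ZMod q, ¬ IsUnit j → Φ j = 0 := fun j hj => by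
    simp only [hΦ, hsupp j hj, Rat.cast_zero]
  -- `Σ_j Φ(j) ζ_j = 0`
  have hq0 : (q : ℂ) ≠ 0 := by exact_mod_cast NeZero.ne q
  have hsum : ∑ j : ZMod q, Φ j * hurwitzZeta (ZMod.toAddCircle j) k = 0 := by
    have h : ZMod.LFunction Φ k = 0 := hL
    rw [ZMod.LFunction, mul_eq_zero] at h
    exact h.resolve_left (by rw [cpow_neg, cpow_natCast]; exact inv_ne_zero (pow_ne_zero _ hq0))
  -- fold onto the half-system
  set H : Finset ℕ := (range q).filter (fun a => 2 * a < q ∧ a.Coprime q) with hH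
  have hmemH : ∀ a : ℕ, a ∈ H ↔ 2 * a < q ∧ a.Coprime q := fun a => by
    simp only [hH, Finset.mem_filter, Finset.mem_range]
    exact ⟨fun h => h.2, fun h => ⟨by omega, h⟩⟩
  rw [ChowlaMilnorL.sum_mul_eq_sum_half hq hΦpar hΦsupp] at hsum
  -- the real relation among Okada's numbers
  set P : ℕ → Prop := fun a => 2 * a < q ∧ Nat.Coprime a q with hP
  set R : {a : ℕ // P a} → ℝ := fun a =>
    (∑' n : ℕ, 1 / ((n : ℝ) + (a : ℕ) / (q : ℝ)) ^ k) +
      (-1 : ℝ) ^ k * ∑' n : ℕ, 1 / ((n : ℝ) + (1 - (a : ℕ) / (q : ℝ))) ^ k with hR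
  have hli : LinearIndependent ℚ R := okada_linearIndependent_hurwitzZeta_holds k q hk (by omega)
  classical
  set s : Finset {a : ℕ // P a} := (range q).subtype P with hs
  have hrel : ∑ i ∈ s, (f ((i : ℕ) : ZMod q)) • R i = 0 := by
    apply Complex.ofReal_injective
    rw [Complex.ofReal_sum, Complex.ofReal_zero, ← hsum, hs,
      Finset.sum_subtype_eq_sum_filter (f := fun a : ℕ =>
        (((f (a : ZMod q)) • ((∑' n : ℕ, 1 / ((n : ℝ) + (a : ℕ) / (q : ℝ)) ^ k) +
          (-1 : ℝ) ^ k * ∑' n : ℕ, 1 / ((n : ℝ) + (1 - (a : ℕ) / (q : ℝ))) ^ k) : ℝ) : ℂ))]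
    refine Finset.sum_congr rfl fun a ha => ?_
    have ha' := ((hmemH a).mp ha).1
    rw [Rat.smul_def, Complex.ofReal_mul, Complex.ofReal_ratCast,
      Okada.ofReal_hurwitz_symm hk (by omega : a ≤ q)]
  have hzero : ∀ i ∈ s, f ((i : ℕ) : ZMod q) = 0 := linearIndependent_iff'.mp hli s _ hrel
  -- hence `f = 0`
  apply hf
  funext j
  simp only [Pi.zero_apply]
  by_cases hu : IsUnit j
  · obtain ⟨a, ha2, hacop, h⟩ := ChowlaMilnorL.exists_half_rep hq hu
    have hmem : (⟨a, ⟨ha2, hacop⟩⟩ : {a : ℕ // P a}) ∈ s := by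
      rw [hs, Finset.mem_subtype]
      exact Finset.mem_range.mpr (show a < q by omega)
    have hfa : f (a : ZMod q) = 0 := hzero _ hmem
    rcases h with h | h
    · rwa [h] at hfa
    · rw [h] at hfa
      have h2 := hpar j
      rw [hfa] at h2
      have hk0 : ((-1 : ℚ) ^ k) ≠ 0 := pow_ne_zero _ (by norm_num)
      exact (mul_eq_zero.mp h2.symm).resolve_left hk0
  · exact hsupp j hu

/-- **The parity-`(−1)^k` half of the Chowla–Chowla–Milnor conjecture holds — PROVED.** Let `p` be a prime, `k ≥ 2`,
and `f : ℤ/pℤ → ℚ` with `f(−a) = (−1)^k f(a)` for all `a`. If `L(k, f) = 0` then `f` is the exceptional function of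
the Chowla–Chowla conjecture: `f(a) = f(0)/(1 − p^k)` for all `a ≢ 0` (for odd `k` this forces `f = 0`). From the
p. 1329 display and `LFunction_natCast_ne_zero_of_parity` applied to `a ↦ f(a) + f(0)/(p^k − 1)` (`a ≢ 0`), `0 ↦ 0`.
[cite: GunRammurtyRath2011, p. 1329 (display) with Theorem 1 (proof, p. 1332)] -/
theorem chowlaChowla_of_parity {p : ℕ} [Fact p.Prime] {k : ℕ} (hk : 2 ≤ k) (f : ZMod p → ℚ)
    (hpar : ∀ a : ZMod p, f (-a) = (-1) ^ k * f a)
    (hL : ZMod.LFunction (fun j => ((f j : ℚ) : ℂ)) k = 0) :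
    ∀ a : ZMod p, a ≠ 0 → f a = f 0 / (1 - (p : ℚ) ^ k) := by
  classical
  have hp : 2 ≤ p := (Fact.out : p.Prime).two_le
  by_cases hp2 : p = 2
  · -- `p = 2`: the only non-zero residue is `1 = −1`; read off the display directly
    subst hp2
    intro a ha
    have ha1 : a = 1 := by
      fin_cases a
      · exact absurd rfl ha
      · rfl
    subst ha1
    have h := pow_mul_LFunction_eq_sum_Ico (N := 2) le_rfl hk (fun j => ((f j : ℚ) : ℂ))
    rw [hL, mul_zero, show Finset.Ico 1 2 = {1} by decide, Finset.sum_singleton] at h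
    have hpos : (0 : ℝ) < hurwitzValue k (((1 : ℕ) : ℝ) / (2 : ℕ)) := hurwitzValue_pos (by norm_num) hk
    have hne : ((hurwitzValue k (((1 : ℕ) : ℝ) / (2 : ℕ)) : ℝ) : ℂ) ≠ 0 := by
      exact_mod_cast hpos.ne'
    have h2 := (mul_eq_zero.mp h.symm).resolve_right hne
    have h21 : ((2 : ℕ) : ℂ) ^ k - 1 ≠ 0 := by
      have hr : (1 : ℝ) < (2 : ℝ) ^ k := one_lt_pow₀ (by norm_num) (by omega)
      have h' : (((2 : ℕ) : ℂ) ^ k - 1) = (((2 : ℝ) ^ k - 1 : ℝ) : ℂ) := by push_cast; ring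
      rw [h']; exact_mod_cast (sub_pos.mpr hr).ne'
    have hq21 : (1 : ℚ) - (2 : ℕ) ^ k ≠ 0 := by
      have hr : (1 : ℚ) < (2 : ℚ) ^ k := one_lt_pow₀ (by norm_num) (by omega)
      push_cast; exact (sub_neg.mpr hr).ne
    have h3 : (((f 1 : ℚ) : ℂ)) * (((2 : ℕ) : ℂ) ^ k - 1) + ((f 0 : ℚ) : ℂ) = 0 := by
      field_simp at h2
      linear_combination h2
    have h4 : ((f 1 * ((2 : ℚ) ^ k - 1) + f 0 : ℚ) : ℂ) = 0 := by push_cast at h3 ⊢; linear_combination h3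
    have h5 : f 1 * ((2 : ℚ) ^ k - 1) + f 0 = 0 := by exact_mod_cast h4
    rw [eq_div_iff hq21]
    push_cast
    linear_combination -h5
  have hp3 : 2 < p := by omega
  -- the shifted function `g`
  set c : ℚ := f 0 / ((p : ℚ) ^ k - 1) with hc
  set g : ZMod p → ℚ := fun a => if a = 0 then 0 else f a + c with hg
  have hpk : (p : ℚ) ^ k - 1 ≠ 0 := by
    have h : (1 : ℚ) < (p : ℚ) ^ k := one_lt_pow₀ (by exact_mod_cast hp) (by omega)
    exact (sub_pos.mpr h).ne'
  -- parity of `g`: `c = (−1)^k c` (for odd `k`, `f(0) = −f(0)` gives `c = 0`)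
  have hc_par : c = (-1) ^ k * c := by
    rcases Nat.even_or_odd k with he | ho
    · rw [he.neg_one_pow, one_mul]
    · have h0 := hpar 0
      rw [neg_zero, ho.neg_one_pow] at h0
      have : f 0 = 0 := by linarith
      simp [hc, this]
  have hgpar : ∀ a : ZMod p, g (-a) = (-1) ^ k * g a := by
    intro a
    by_cases ha : a = 0
    · simp [hg, ha]
    · have hna : -a ≠ 0 := fun h => ha (neg_eq_zero.mp h)
      simp only [hg, if_neg ha, if_neg hna, hpar a]
      linear_combination hc_par
  have hgsupp : ∀ a : ZMod p, ¬ IsUnit a → g a = 0 := by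
    intro a ha
    have ha0 : a = 0 := by
      by_contra h
      exact ha (isUnit_iff_ne_zero.mpr h)
    simp [hg, ha0]
  -- `L(k, g) = 0` by the display of p. 1329 applied to `f` and to `g`
  have hLg : ZMod.LFunction (fun j => ((g j : ℚ) : ℂ)) k = 0 := by
    have hf' := pow_mul_LFunction_eq_sum_Ico hp hk (fun j => ((f j : ℚ) : ℂ))
    have hg' := pow_mul_LFunction_eq_sum_Ico hp hk (fun j => ((g j : ℚ) : ℂ))
    have hsame : ∀ a ∈ Finset.Ico 1 p,
        ((((g (a : ZMod p)) : ℚ) : ℂ) + ((g 0 : ℚ) : ℂ) / ((p : ℂ) ^ k - 1)) =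
          ((((f (a : ZMod p)) : ℚ) : ℂ) + ((f 0 : ℚ) : ℂ) / ((p : ℂ) ^ k - 1)) := by
      intro a ha
      have ha' := Finset.mem_Ico.mp ha
      have hne : ((a : ℕ) : ZMod p) ≠ 0 := by
        rw [Ne, ZMod.natCast_eq_zero_iff]
        exact Nat.not_dvd_of_pos_of_lt ha'.1 ha'.2
      simp only [hg, if_neg hne, if_pos rfl, hc]
      push_cast
      ring
    have heq : (p : ℂ) ^ k * ZMod.LFunction (fun j => ((g j : ℚ) : ℂ)) k =
        (p : ℂ) ^ k * ZMod.LFunction (fun j => ((f j : ℚ) : ℂ)) k := by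
      rw [hf', hg']
      exact Finset.sum_congr rfl fun a ha => by rw [hsame a ha]
    rw [hL, mul_zero, mul_eq_zero] at heq
    exact heq.resolve_left (pow_ne_zero _ (by exact_mod_cast (NeZero.ne p)))
  -- so `g = 0`
  have hg0 : g = 0 := by
    by_contra hne
    exact LFunction_natCast_ne_zero_of_parity hp3 hk g hgpar hgsupp hne hLg
  intro a ha
  have h := congrFun hg0 a
  simp only [hg, if_neg ha, Pi.zero_apply] at h
  have hpk' : (1 : ℚ) - (p : ℚ) ^ k ≠ 0 := fun h0 => hpk (by linear_combination -h0)
  have h' : f a = -(f 0 / ((p : ℚ) ^ k - 1)) := by rw [hc] at h; linear_combination h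
  rw [eq_div_iff hpk', h']
  field_simp
  ring

end Literature.NumberTheory.Irrationality.DirichletLValues

end
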